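import Summits.Ventures.PercRepro.Night2StarLine

/-!
# PercRepro — night-2: the pure line pays `(★)` for every `q` and every corank (blind cell pub-perc-repro, night-2 gen 1)

Lemma 9 of `proofs/NIGHT-2-star.md` (mine-4's closed form (3.4)) in its two crude halves, over `Night2StarLine`:
* `d ≤ q + 2`: the `d + 1` non-demanded sets `D ∪ B`, `(D ∖ x) ∪ B` pay `(2q/(q−1))·(d+3)/((d+1)(d+2)) ≥ 2/(q+1)` (`line_core`);
* `d ≥ q + 3`: the `2^d − d − 2` sets with `1 ≤ |T| ≤ d − 2` pay `≥ 2(2^d − d − 2)/((q−1)(q+1)C(d+2,2)) ≥ 2/(q+1)`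
  (`two_pow_bound`: `2·2^d ≥ (d − 4)(d + 2)(d + 1) + 2d + 4` for `d ≥ 5`).
* **`rec_ge_of_line`** — the pure line satisfies `(★)` for every `q ≥ 2` and every corank `d ≥ 2`.
With `rec_ge_of_cross_pairs` (`Night2StarCross`) this puts every all-triangle basis of corank `≥ 19` in the kernel: the largest
parallel class `g₁` of its B-lines either is everything (the pure line) or leaves `g₁(d − g₁) ≥ d − 1 ≥ 18` cross pairs.
-/

namespace PercRepro.Star

open Finset ThmH SixFour GenQ

variable {α : Type*} [DecidableEq α] {M : Matroid α} [M.Finite]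

/-! ## The two arithmetic halves -/

/-- `2·2^d ≥ (d − 4)(d + 2)(d + 1) + 2d + 4` for `d ≥ 5`. -/
theorem two_pow_bound (d : ℕ) (hd : 5 ≤ d) :
    ((d : ℚ) - 4) * ((d : ℚ) + 2) * ((d : ℚ) + 1) + 2 * (d : ℚ) + 4 ≤ 2 * (2 : ℚ) ^ d := by
  rcases Nat.lt_or_ge d 6 with h5 | h6
  · have : d = 5 := by omega
    subst this
    norm_num
  · induction d, h6 using Nat.le_induction with
    | base => norm_num
    | succ n hn ih =>
      have ih' := ih (by omega)
      have hn' : (6 : ℚ) ≤ n := by exact_mod_cast hn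
      push_cast
      rw [pow_succ]
      nlinarith [mul_nonneg (sub_nonneg.2 hn') (by positivity : (0 : ℚ) ≤ (n : ℚ) ^ 2 + 2 * n + 3)]

/-- `(n.choose 2 : ℚ) · 2 = n (n − 1)`. -/
theorem cast_choose_two (n : ℕ) : ((n.choose 2 : ℕ) : ℚ) * 2 = (n : ℚ) * ((n : ℚ) - 1) := by
  have h := two_mul_choose_two n
  rcases n with _ | n
  · simp
  · have h' : ((2 * (n + 1).choose 2 : ℕ) : ℚ) = (((n + 1) * n : ℕ) : ℚ) := by
      rw [h, Nat.add_sub_cancel]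
    push_cast at h' ⊢
    linarith

/-- `(q − 1)(d + 1)(d + 2) ≤ q(q + 1)(d + 3)` for `2 ≤ d ≤ q + 2` (the corank-`≤ q + 2` half of Lemma 9). -/
theorem line_core (q d : ℕ) (hq : 2 ≤ q) (hd : 2 ≤ d) (hsmall : d ≤ q + 2) :
    ((q : ℚ) - 1) * ((d : ℚ) + 1) * ((d : ℚ) + 2) ≤ (q : ℚ) * ((q : ℚ) + 1) * ((d : ℚ) + 3) := by
  rcases Nat.lt_or_ge q 4 with h4 | h4
  · have hq3 : q ≤ 3 := by omega
    have hd5 : d ≤ 5 := by omega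
    interval_cases q <;> interval_cases d <;> norm_num
  · have hq' : (4 : ℚ) ≤ q := by exact_mod_cast h4
    have hd' : (2 : ℚ) ≤ d := by exact_mod_cast hd
    have hs : (d : ℚ) ≤ (q : ℚ) + 2 := by exact_mod_cast hsmall
    nlinarith [mul_nonneg (mul_nonneg (by linarith : (0:ℚ) ≤ q) (by linarith : (0:ℚ) ≤ d)) (sub_nonneg.2 hs),
      mul_nonneg (sub_nonneg.2 hs) (by linarith : (0:ℚ) ≤ 3 * (q:ℚ) - 5 - d)]

/-- The index set `T ↦ T ∪ B` over the nonempty subsets of `D = G ∖ B` sits inside the index set of `rec`. -/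
theorem sum_line_le_rec (hs : Simple M) {G B : Finset α} {q : ℕ} (hG : G ⊆ gr M)
    (hrG : M.eRk (G : Set α) = (q : ℕ∞)) (hB : B ∈ Bq M G q) {P : Finset (Finset α)}
    (hP : P ⊆ (G \ B).powerset) (hPne : ∀ T ∈ P, T.Nonempty) :
    ∑ T ∈ P, surplus M G q (T ∪ B) / (bIn M G q (T ∪ B) : ℚ) ≤ rec M G q B := by
  set f : Finset α → ℚ := fun S => surplus M G q S / (bIn M G q S : ℚ) with hf
  have hmem : ∀ T ∈ P, T ⊆ G \ B := fun T hT => Finset.mem_powerset.1 (hP hT)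
  have hinj : Set.InjOn (fun T : Finset α => T ∪ B) (P : Set (Finset α)) := by
    intro T hT T' hT' heq
    have e : ∀ U ∈ P, (U ∪ B) \ B = U := by
      intro U hU
      rw [Finset.union_sdiff_right, Finset.sdiff_eq_self_iff_disjoint, Finset.disjoint_left]
      intro z hz hzB
      exact (Finset.mem_sdiff.1 (hmem U hU hz)).2 hzB
    simp only at heq
    rw [← e T (Finset.mem_coe.1 hT), ← e T' (Finset.mem_coe.1 hT'), heq]
  have hsub : P.image (fun T : Finset α => T ∪ B) ⊆ (SNq M G q).filter (fun S : Finset α => B ⊆ S) := by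
    intro S hS
    rw [Finset.mem_image] at hS
    obtain ⟨T, hT, rfl⟩ := hS
    exact Finset.mem_filter.2 ⟨(union_mem_SNq hrG hB (hmem T hT) (hPne T hT)).1, Finset.subset_union_right⟩
  have h1 : ∑ S ∈ P.image (fun T : Finset α => T ∪ B), f S ≤ rec M G q B := by
    unfold rec
    apply Finset.sum_le_sum_of_subset_of_nonneg hsub
    intro S hS _
    have hS' := (Finset.mem_filter.1 hS).1
    apply div_nonneg (surplus_nonneg hs hG hrG hS')
    positivity
  rw [Finset.sum_image hinj] at h1
  exact h1

/-- **The pure line satisfies `(★)`**: if every point of `G ∖ B` lies on the line through two points `a, b` of the basis `B`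
(and `|G ∖ B| ≥ 2`), then `rec(B) ≥ 2/(q + 1)`, for every `q ≥ 2`. -/
theorem rec_ge_of_line (hs : Simple M) {G B : Finset α} {q : ℕ} (hG : G ⊆ gr M)
    (hrG : M.eRk (G : Set α) = (q : ℕ∞)) (hB : B ∈ Bq M G q) (hq : 2 ≤ q) {a b : α} (ha : a ∈ B) (hb : b ∈ B)
    (hab : a ≠ b) (hline : ∀ x ∈ G \ B, x ∈ M.closure ({a, b} : Set α)) (hd : 2 ≤ (G \ B).card) :
    2 / ((q : ℚ) + 1) ≤ rec M G q B := by
  set D := G \ B with hD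
  set d := D.card with hd_def
  set f : Finset α → ℚ := fun S => surplus M G q S / (bIn M G q S : ℚ) with hf
  have hq' : (2 : ℚ) ≤ q := by exact_mod_cast hq
  have hq1 : (0 : ℚ) < (q : ℚ) - 1 := by linarith
  have hq2 : (0 : ℚ) < (q : ℚ) + 1 := by linarith
  have hd' : (2 : ℚ) ≤ d := by exact_mod_cast hd
  have hΦ : ((q : ℚ) + 2) / ((q : ℚ) + 1) ≤ (q : ℚ) / ((q : ℚ) - 1) := by
    rw [div_le_div_iff₀ hq2 hq1]
    nlinarith
  rcases Nat.lt_or_ge (q + 2) d with hbig | hsmall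
  · -- `d ≥ q + 3`: the sets with `1 ≤ |T| ≤ d − 2`
    set P := D.powerset.filter (fun T : Finset α => 1 ≤ T.card ∧ T.card ≤ d - 2) with hP
    have hPsub : P ⊆ D.powerset := Finset.filter_subset _ _
    have hPne : ∀ T ∈ P, T.Nonempty := fun T hT => by
      have := (Finset.mem_filter.1 hT).2.1
      exact Finset.card_pos.1 (by omega)
    have hrec := sum_line_le_rec hs hG hrG hB hPsub hPne
    -- each term
    have hterm : ∀ T ∈ P, ((q : ℚ) / ((q : ℚ) - 1) - ((q : ℚ) + 2) / ((q : ℚ) + 1)) / ((d + 2).choose 2 : ℚ) ≤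
        f (T ∪ B) := by
      intro T hT
      have hTD := Finset.mem_powerset.1 (hPsub hT)
      have h1 := (line_term_ge hs hG hrG hB hq ha hb hab hline hTD (hPne T hT)).1
      have hTc : T.card + 2 ≤ d + 2 := by
        have := Finset.card_le_card hTD
        omega
      have hch : ((T.card + 2).choose 2 : ℚ) ≤ ((d + 2).choose 2 : ℚ) := by
        exact_mod_cast Nat.choose_le_choose 2 hTc
      have hpos : (0 : ℚ) < ((T.card + 2).choose 2 : ℚ) := by
        exact_mod_cast Nat.choose_pos (by omega)
      refine le_trans ?_ h1
      exact div_le_div_of_nonneg_left (by linarith) hpos hch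
    -- the count
    have hcount : 2 ^ d ≤ P.card + (d + 2) := by
      have hsplit := Finset.card_filter_add_card_filter_not
        (s := D.powerset) (p := fun T : Finset α => 1 ≤ T.card ∧ T.card ≤ d - 2)
      have hneg : (D.powerset.filter (fun T : Finset α => ¬ (1 ≤ T.card ∧ T.card ≤ d - 2))) ⊆
          insert (∅ : Finset α) (insert D (D.powersetCard (d - 1))) := by
        intro T hT
        rw [Finset.mem_filter, Finset.mem_powerset] at hT
        rw [Finset.mem_insert, Finset.mem_insert, Finset.mem_powersetCard]
        have hTc := Finset.card_le_card hT.1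
        by_cases h0 : T.card = 0
        · left; exact Finset.card_eq_zero.1 h0
        · right
          have hbig' : d - 1 ≤ T.card := by
            have h2 := hT.2
            rw [not_and_or, not_le, not_le] at h2
            rcases h2 with h | h <;> omega
          by_cases hTd : T.card = d
          · left; exact Finset.eq_of_subset_of_card_le hT.1 (by omega)
          · right; exact ⟨hT.1, by omega⟩
      have hc := Finset.card_le_card hneg
      have hc2 : (insert (∅ : Finset α) (insert D (D.powersetCard (d - 1)))).card ≤ d + 2 := by
        calc (insert (∅ : Finset α) (insert D (D.powersetCard (d - 1)))).card
            ≤ (insert D (D.powersetCard (d - 1))).card + 1 := Finset.card_insert_le _ _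
          _ ≤ (D.powersetCard (d - 1)).card + 1 + 1 := by
              have := Finset.card_insert_le D (D.powersetCard (d - 1)); omega
          _ = d.choose (d - 1) + 2 := by rw [Finset.card_powersetCard]
          _ = d + 2 := by
              rw [show d - 1 = d - 1 from rfl, Nat.choose_symm (by omega : 1 ≤ d), Nat.choose_one_right]
      rw [Finset.card_powerset, ← hd_def, ← hP] at hsplit
      omega
    have hcountq : (2 : ℚ) ^ d - d - 2 ≤ P.card := by
      have : ((2 ^ d : ℕ) : ℚ) ≤ ((P.card + (d + 2) : ℕ) : ℚ) := by exact_mod_cast hcount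
      push_cast at this
      linarith
    have hsum := Finset.card_nsmul_le_sum P _ _ hterm
    rw [nsmul_eq_mul] at hsum
    simp only [hf] at hrec hsum
    -- arithmetic: `(2^d − d − 2)·[q/(q−1) − Φ]/C(d+2,2) ≥ 2/(q+1)`
    have hC : ((d + 2).choose 2 : ℚ) * 2 = ((d : ℚ) + 2) * ((d : ℚ) + 1) := by
      have := cast_choose_two (d + 2)
      push_cast at this
      linarith
    have hCpos : (0 : ℚ) < ((d + 2).choose 2 : ℚ) := by exact_mod_cast Nat.choose_pos (by omega)
    have hsurp : (q : ℚ) / ((q : ℚ) - 1) - ((q : ℚ) + 2) / ((q : ℚ) + 1) = 2 / (((q : ℚ) - 1) * ((q : ℚ) + 1)) := by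
      field_simp
      ring
    have hbig' : (q : ℚ) + 3 ≤ d := by exact_mod_cast hbig
    have hd5 : 5 ≤ d := by omega
    have hpow := two_pow_bound d hd5
    have hC' : ((q : ℚ) - 1) * (((d : ℚ) + 2) * ((d : ℚ) + 1)) ≤ 2 * ((2 : ℚ) ^ d - d - 2) := by
      nlinarith [mul_nonneg (sub_nonneg.2 hbig') (by positivity : (0 : ℚ) ≤ ((d : ℚ) + 2) * ((d : ℚ) + 1))]
    have hX : ((q : ℚ) - 1) * ((d + 2).choose 2 : ℚ) ≤ (2 : ℚ) ^ d - d - 2 := by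
      have := congrArg (fun t : ℚ => ((q : ℚ) - 1) * t) hC
      have h2 : ((q : ℚ) - 1) * (((d + 2).choose 2 : ℚ) * 2) = ((q : ℚ) - 1) * (((d : ℚ) + 2) * ((d : ℚ) + 1)) := this
      linarith
    have hkey : 2 / ((q : ℚ) + 1) ≤ ((2 : ℚ) ^ d - d - 2) *
        (((q : ℚ) / ((q : ℚ) - 1) - ((q : ℚ) + 2) / ((q : ℚ) + 1)) / ((d + 2).choose 2 : ℚ)) := by
      rw [hsurp]
      have e : ((2 : ℚ) ^ d - d - 2) * ((2 / (((q : ℚ) - 1) * ((q : ℚ) + 1))) / ((d + 2).choose 2 : ℚ)) =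
          2 * ((2 : ℚ) ^ d - d - 2) / ((((q : ℚ) - 1) * ((q : ℚ) + 1)) * ((d + 2).choose 2 : ℚ)) := by
        field_simp
      rw [e, div_le_div_iff₀ hq2 (by positivity)]
      nlinarith [mul_le_mul_of_nonneg_left hX (by positivity : (0 : ℚ) ≤ 2 * ((q : ℚ) + 1))]
    have hmono : ((2 : ℚ) ^ d - d - 2) *
        (((q : ℚ) / ((q : ℚ) - 1) - ((q : ℚ) + 2) / ((q : ℚ) + 1)) / ((d + 2).choose 2 : ℚ)) ≤
        (P.card : ℚ) * (((q : ℚ) / ((q : ℚ) - 1) - ((q : ℚ) + 2) / ((q : ℚ) + 1)) / ((d + 2).choose 2 : ℚ)) := by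
      apply mul_le_mul_of_nonneg_right hcountq
      apply div_nonneg (by linarith) hCpos.le
    linarith
  · -- `d ≤ q + 2`: the `d + 1` non-demanded sets `D` and `D ∖ x`
    set P := insert D (D.image (fun x => D.erase x)) with hP
    have hDne : D.Nonempty := Finset.card_pos.1 (by omega)
    have hPsub : P ⊆ D.powerset := by
      intro T hT
      rw [hP, Finset.mem_insert, Finset.mem_image] at hT
      rw [Finset.mem_powerset]
      rcases hT with rfl | ⟨x, -, rfl⟩
      · exact Finset.Subset.refl _
      · exact Finset.erase_subset x D
    have hPne : ∀ T ∈ P, T.Nonempty := by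
      intro T hT
      rw [hP, Finset.mem_insert, Finset.mem_image] at hT
      rcases hT with rfl | ⟨x, hx, rfl⟩
      · exact hDne
      · apply Finset.card_pos.1
        rw [Finset.card_erase_of_mem hx]
        omega
    have hrec := sum_line_le_rec hs hG hrG hB hPsub hPne
    have hDnotin : D ∉ D.image (fun x => D.erase x) := by
      intro h
      rw [Finset.mem_image] at h
      obtain ⟨x, hx, hxe⟩ := h
      have := congrArg Finset.card hxe
      rw [Finset.card_erase_of_mem hx] at this
      omega
    have hinj : Set.InjOn (fun x => D.erase x) (D : Set α) := by
      intro x hx y hy hxy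
      simp only at hxy
      by_contra hne
      have : x ∈ D.erase y := Finset.mem_erase.2 ⟨hne, Finset.mem_coe.1 hx⟩
      rw [← hxy] at this
      exact (Finset.mem_erase.1 this).1 rfl
    rw [hP, Finset.sum_insert hDnotin, Finset.sum_image hinj] at hrec
    -- the terms
    have hC2 : ((d + 2).choose 2 : ℚ) * 2 = ((d : ℚ) + 2) * ((d : ℚ) + 1) := by
      have := cast_choose_two (d + 2); push_cast at this; linarith
    have hC1 : ((d + 1).choose 2 : ℚ) * 2 = ((d : ℚ) + 1) * (d : ℚ) := by
      have := cast_choose_two (d + 1); push_cast at this; linarith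
    have hC2pos : (0 : ℚ) < ((d + 2).choose 2 : ℚ) := by exact_mod_cast Nat.choose_pos (by omega)
    have hC1pos : (0 : ℚ) < ((d + 1).choose 2 : ℚ) := by exact_mod_cast Nat.choose_pos (by omega)
    have htop : ((q : ℚ) / ((q : ℚ) - 1)) / ((d + 2).choose 2 : ℚ) ≤ f (D ∪ B) := by
      have h := (line_term_ge hs hG hrG hB hq ha hb hab hline (Finset.Subset.refl D) hDne).2
      apply h
      rw [hD, Finset.sdiff_union_of_subset (mem_Bq.1 hB).1, Finset.sdiff_self, Finset.card_empty]
      omega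
    have hx : ∀ x ∈ D, ((q : ℚ) / ((q : ℚ) - 1)) / ((d + 1).choose 2 : ℚ) ≤ f ((D.erase x) ∪ B) := by
      intro x hx
      have hne : (D.erase x).Nonempty := by
        apply Finset.card_pos.1
        rw [Finset.card_erase_of_mem hx]
        omega
      have h := (line_term_ge hs hG hrG hB hq ha hb hab hline (Finset.erase_subset x D) hne).2
      rw [Finset.card_erase_of_mem hx, show d - 1 + 2 = d + 1 by omega] at h
      apply h
      have hsub : G \ ((D.erase x) ∪ B) ⊆ {x} := by
        intro z hz
        rw [Finset.mem_sdiff, Finset.mem_union, not_or, Finset.mem_erase, not_and] at hz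
        rw [Finset.mem_singleton]
        have hzD : z ∈ D := Finset.mem_sdiff.2 ⟨hz.1, hz.2.2⟩
        by_contra hzx
        exact hz.2.1 hzx hzD
      have := Finset.card_le_card hsub
      rw [Finset.card_singleton] at this
      exact this
    have hsumx : (d : ℚ) * (((q : ℚ) / ((q : ℚ) - 1)) / ((d + 1).choose 2 : ℚ)) ≤
        ∑ x ∈ D, f ((D.erase x) ∪ B) := by
      rw [hd_def, ← nsmul_eq_mul]
      exact Finset.card_nsmul_le_sum D _ _ hx
    simp only [hf] at hrec htop hsumx
    -- arithmetic: `(q/(q−1))·[1/C(d+2,2) + d/C(d+1,2)] ≥ 2/(q+1)`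
    have hd0 : (0 : ℚ) < d := by linarith
    have hC2' : ((d + 2).choose 2 : ℚ) = ((d : ℚ) + 2) * ((d : ℚ) + 1) / 2 := by linarith
    have hC1' : ((d + 1).choose 2 : ℚ) = ((d : ℚ) + 1) * (d : ℚ) / 2 := by linarith
    have hcore := line_core q d hq hd hsmall
    have hkey : 2 / ((q : ℚ) + 1) ≤ ((q : ℚ) / ((q : ℚ) - 1)) / ((d + 2).choose 2 : ℚ) +
        (d : ℚ) * (((q : ℚ) / ((q : ℚ) - 1)) / ((d + 1).choose 2 : ℚ)) := by
      rw [hC2', hC1']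
      have e1 : ((q : ℚ) / ((q : ℚ) - 1)) / (((d : ℚ) + 2) * ((d : ℚ) + 1) / 2) =
          2 * (q : ℚ) / (((q : ℚ) - 1) * (((d : ℚ) + 2) * ((d : ℚ) + 1))) := by
        field_simp
      have e2 : (d : ℚ) * (((q : ℚ) / ((q : ℚ) - 1)) / (((d : ℚ) + 1) * (d : ℚ) / 2)) =
          2 * (q : ℚ) / (((q : ℚ) - 1) * ((d : ℚ) + 1)) := by
        field_simp
      have hpos : (0 : ℚ) < 2 * ((q : ℚ) - 1) * ((d : ℚ) + 1) := by positivity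
      rw [e1, e2, div_add_div _ _ (by positivity) (by positivity), div_le_div_iff₀ hq2 (by positivity)]
      nlinarith [mul_le_mul_of_nonneg_left hcore hpos.le]
    linarith


end PercRepro.Star
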